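/-
# `Balaban1983to89.B5SupDominatedTorus` — Bałaban CMP 95 (1984), Proposition 1.2, step S1 AS PRINTED on the torus of record:
# THE WALK PROBLEMS — every point value / Hölder quotient of the entries (1.110)–(1.113) for `G = Δ_a⁻¹` of record is
# `B5SupWalk131.Dominated` (direct problems on `ℓ^∞`, adjoint problems on `ℓ¹`), with `O(1)`s depending on `d` only

statement-level skeleton of published theorems with citation tags; proofs where landed; nothing here is a claim
about the Yang–Mills mass gap

CITATION HEADER (lean-in-tree rule).  Cell `lit-balaban`, unit `lit-balaban-p38` (Phase-2 proof seat p38 gen 8), HOME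
`run/shared/lean/pub/lit-balaban/` (SKELETON rows B5.Eq1.125, B5.Eq1.129, B5.Eq1.130, B5.Eq1.131, B5.Prop1.2; owner r02).
B5 = T. Bałaban, *Propagators and renormalization transformations for lattice gauge theories. I*, Commun. Math. Phys. **95**
(1984) 17–40 [`Balaban1984PropagatorsI`], held as `paper:balaban1984-cmp95-propagators-rt-i` (journal page = PDF page + 16).
FILE D₁ of the p38-gen-8 half (DomCert side) of the sup/Hölder (S1) torus instantiation of `B5SupWalkS1.SupRealisation`
(B5-CLOSURE §5 item 2); FILES A/B/C/C′ = `B5SupCarrierTorus` / `B5SupHolderTorus` / `B5SupFactor125Torus` /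
`B5SupFactor129AdjTorus`.

WHAT IS PRINTED (pp. 37–39 [PDF 21–23]), verbatim.  p. 37 last line – p. 38 L6: «For example let us prove the inequality
(1.113) assuming the inequalities (1.115)-(1.117). Let us consider ζ∇G∇*J. We represent G by the sum in (1.123) and we
estimate the norm ‖ζ∇G∇*J‖_α by the sum of norms. To estimate terms in this sum we have to understand properties of factors in
each term. There are two types of factors, with the operator G and with the operator K(h). The factors with G are estimated by
using (1.115). For the first factor we have ‖ζ∇h_zGh_zA‖_α ≤ O(1)(‖ζ‖_α + |ζ|)|h_zA|. (1.125)»; p. 38: «The last factor in each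
term is estimated by using (1.115), (1.116) … (1.129) There is one possibility left yet, namely that of the terms with one
factor. Then we apply the inequality (1.117) together with (1.115), (1.116) and we get … (1.130) Gathering together all these
estimates we obtain … (1.131)», the sum in (1.131) running over the sequences ω = (ω₀, …, ω_n) of cube centres with
y ∈ □_{ω₀}, y′ ∈ □_{ω_n}; p. 39 L1–3: «Let us notice that the constant O(1) under the sum above is an absolute constant depending
on d only, hence we can fix M₀ depending on d only, such that the series is convergent.»; p. 39 L6–8: «The proofs of the other
inequalities are exactly the same, but in the estimates of G∇*J we have to take a representation of G adjoint to (1.123), with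
the operators K(h) acting on the right.»

WHAT THIS MODULE PROVES (kernel-checked, zero sorry) — for the real setting of record `B5SettingP12Real.latticeSettingP12R n M a k`
(`n ≥ 1`, `a > 0`), `G` read on the carriers of FILE A (`Gs/Hs/Dgs` on `VecR n M`; `G1/H1/Dg1` on `V1 n M`), the cube
geometry of `B5WalkTorusGeom` (`ctr`, `sitePt`, `M₀ ≥ 1`), ANY `κ : SupConsts` with `11/3 ≤ κ.c̄`, `cFmax ≤ κ.c_F`,
`cLmax ≤ κ.c_L`, `c1max ≤ κ.c₁` (d-only constants below), under `hG : B5.Global115_117 … C C_α C_ε C_{α,ε}`, `0 < C`: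
§1 generic packaging (`adm_of_bounds`, `dominated_of_witness`, the null problem `dominated_zero`), the envelope inequalities;
§2 the output functionals (evaluation, gradient entry, Laplacian entry, `ζ`-Hölder quotient on `ℓ^∞`; `⟨∇·, T⟩` on `ℓ¹`) and
   their LOCALITY «y ∈ □_{ω₀}» at radius `c̄M₀` (`c̄ ≥ 11/3`); the source localities «y′ ∈ □_{ω_n}»;
§3 THE DIRECT PROBLEMS ARE DOMINATED: `|(GJ)(b₀)|`, `|(∇GJ)_ν(b₀)|`, `|(ΔGJ)(b₀)|` (1.110) [`A = env C 0 0 0 0`, sizes `1, |J|`];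
   the quotient of `ζ∇GJ` at a pair (1.111) [`env C (C_α α) 0 0 0`, `‖ζ‖_α + |ζ|`, `|J|`]; `|(∇G∇*T)_ν(b₀)|` (1.112) [`env C 0 (C_ε ε) 0 0`,
   `1`, `‖T‖_ε + |T|`]; the quotient of `ζ∇G∇*T` (1.113) [`env C (C_α α) (C_ε ε) (C_ε(α+ε)) (C_{α,ε} α ε)`, `‖ζ‖_α + |ζ|`, `‖T‖_{α+ε} + |T|`];
§4 THE ADJOINT PROBLEMS ARE DOMINATED (p. 39): `|(G∇*T)(b₀)|` (1.110, m = 2) [monopole `|T|e_{b₀}`, output `|T|⁻¹⟨∇·,T⟩`] and the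
   quotient of `ζG∇*T` at a pair (1.111) [source `(|T|/(‖ζ‖_α+|ζ|))|x−x′|^{−α}(ζ(x′)e_{x′μ} − ζ(x)e_{xμ})`, output `((‖ζ‖_α+|ζ|)/|T|)⟨∇·,T⟩`].
The four `DomCert` fields of `SupRealisation` are assembled from these in FILE D₂ (`B5SupCertsTorus`).

HONEST SCOPE / DIVERGENCE.  (1) Constants: ours, explicit, d-only (`cFmax`, `cLmax`, `c1max`), not optimised; the paper՚s `O(1)`.
(2) Sup norms over the whole torus on the right of (1.125) (upper bounds of the printed `|h_zA|`).  (3) The adjoint problems are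
our reading of the one sentence of p. 39 (every bound used is a member of (1.115) for the symmetric `G`); the normalisation of
source/output by `|T|`, `‖ζ‖_α + |ζ|` is bookkeeping forced by the typed sizes of `B5SupWalk131.Adm`.  (4) `a > 0`, `n ≥ 1`
(uniform in `η`, volume, `k`), as everywhere in the P12R lineage.
CELL BOOK-KEEPING (lit-balaban): rows B5.Eq1.125 / B5.Eq1.129 / B5.Eq1.130 / B5.Eq1.131 («walk problems dominated, torus
instance for G of record, direct + adjoint»), B5.Prop1.2 (S1-torus programme, p38 half, file D₁) — cells only, NO head change;
value = the bookkeeping of pp. 37–39 made explicit and kernel-checked for the model of record, NOT summit progress.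
-/
import Mathlib
import Literature.MathematicalPhysics.QuantumFieldTheory.Balaban1983to89.B5SupFactor129AdjTorus
import Literature.MathematicalPhysics.QuantumFieldTheory.Balaban1983to89.B5SupWalkS1

open Finset

namespace Literature.MathematicalPhysics.QuantumFieldTheory.Balaban1983to89.B5SupDominatedTorus

open scoped BigOperators Matrix
open WithLp
open Literature.MathematicalPhysics.QuantumFieldTheory.Balaban1983to89
open Literature.MathematicalPhysics.QuantumFieldTheory.Balaban1983to89.B5SupWalk125 (size)
open Literature.MathematicalPhysics.QuantumFieldTheory.Balaban1983to89.B5SupWalk131 (SupConsts env Adm Dominated)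
open Literature.MathematicalPhysics.QuantumFieldTheory.Balaban1983to89.B5Prop11Plancherel (Tor fine unitVec)
open Literature.MathematicalPhysics.QuantumFieldTheory.Balaban1983to89.B5Prop12FieldsLattice (distU cubeT cubeB holderV holderT
  cutSupL cutHL cutInL distU_nonneg)
open Literature.MathematicalPhysics.QuantumFieldTheory.Balaban1983to89.B5RealFields (GR fdiffR gradR divTR LapR cplx)
open Literature.MathematicalPhysics.QuantumFieldTheory.Balaban1983to89.B5SettingP12Real (LocR VecR latticeSettingP12R gP12R)
open Literature.MathematicalPhysics.QuantumFieldTheory.Balaban1983to89.B5WalkTorusGeom (TorR ucPt sitePt Cen ctr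
  dist_ucPt_le_distU dist_ucPt_sitePt_le_one)
open Literature.MathematicalPhysics.QuantumFieldTheory.Balaban1983to89.B5WalkPartitionTorus (hz dist_ctr_le_of_hz_ne_zero)
open Literature.MathematicalPhysics.QuantumFieldTheory.Balaban1983to89.B5WalkCarrierTorus (Bnd)
open Literature.MathematicalPhysics.QuantumFieldTheory.Balaban1983to89.B5WalkLocalityTorus (distU_le_of_fdiffR_ne_zero two_div_le_two)
open Literature.MathematicalPhysics.QuantumFieldTheory.Balaban1983to89.B5WalkH128Torus (gz abs_gz_le_one distU_le_of_LapR_ne_zero)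
open Literature.MathematicalPhysics.QuantumFieldTheory.Balaban1983to89.B5CoverP12Lattice (Lw Lw_nonneg distU_comm)
open Literature.MathematicalPhysics.QuantumFieldTheory.Balaban1983to89.B5SupCarrierTorus (Gs Gs_apply Hs Hs_apply Dgs Dgs_apply
  V1 Vg1 G1 H1 Dg1 ofLp_G1 H1_apply ofLp_conj_apply norm_V1 norm_Vg1)
open Literature.MathematicalPhysics.QuantumFieldTheory.Balaban1983to89.B5SupHolderTorus (holS holS_nonneg cutSupL_nonneg' cutHL_eq
  abs_le_cutSupL norm_gz_mul_le)
open Literature.MathematicalPhysics.QuantumFieldTheory.Balaban1983to89.B5SupFactor125Torus (cF1 cF3 cFH cLT c1H one_le_cF1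
  one_le_cF3 one_le_cFH one_le_cLT one_le_c1H Hs_eq_fun abs_gz_G_le abs_G_le abs_gradR_G_le abs_gradR_gz_G_le abs_LapR_gz_G_le
  abs_LapR_G_le_of_global quotH_gz_G_le quotH_G_le last_vec_le last_ten_le holderT_add_norm_mono one_eval_vec_le one_grad_vec_le
  one_Lap_vec_le one_quotH_vec_le one_grad_ten_le one_quotH_ten_le)
open Literature.MathematicalPhysics.QuantumFieldTheory.Balaban1983to89.B5SupFactor129AdjTorus (pair pair_add pair_smul pair_G_eq
  pair_gz_G_gz_eq mono sum_mono_mul l1 l1grad norm_V1_eq_l1 norm_Dg1_eq_l1grad abs_pair_gz_G_le abs_pair_G_le last_mono_le c1A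
  c1A_nonneg abs_gz_G_gz_divTR_le cutSrc sum_cutSrc_mul cut_ne_zero_of_cutSrc_ne_zero cLA two_le_cLA size_cutSrc_le one_cutSrc_le
  l1_smul l1grad_smul G_gz_smul)

noncomputable section

variable {d : ℕ}

/-! ## §1 Generic packaging and the envelope -/

section Generic

variable {V Vg : Type} [SeminormedAddCommGroup V] [Module ℝ V] [SeminormedAddCommGroup Vg] [Module ℝ Vg]
  {S X : Type} [PseudoMetricSpace X]

/-- **an output functional is ADMISSIBLE as soon as its four printed bounds hold with constants below `κ`՚s**
((1.125) first factor, remainder, locality «y ∈ □_{ω₀}», (1.130) one-factor term). [cite: Balaban1984PropagatorsI, (1.125) p.38, (1.130)–(1.131) p.38] -/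
theorem adm_of_bounds (G : Module.End ℝ V) (H : S → Module.End ℝ V) (ctr : S → X) (c : ℝ) (κ : SupConsts)
    {A s₁ m₁ : ℝ} (u : X) (src : V) (D : V →ₗ[ℝ] ℝ) {F O : ℝ}
    (hF : F ≤ κ.cF * A * s₁) (hO : O ≤ κ.c1 * A * s₁ * m₁)
    (h1 : ∀ (z : S) (B : V), ‖D (H z (G B))‖ ≤ F * ‖B‖) (h2 : ∀ B : V, ‖D (G B)‖ ≤ F * ‖B‖)
    (h3 : ∀ z : S, ¬ dist u (ctr z) ≤ c → D ∘ₗ H z = 0) (h4 : ∀ z : S, ‖D (H z (G (H z src)))‖ ≤ O) :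
    Adm G H ctr c κ A s₁ m₁ u src D :=
  ⟨fun z B => (h1 z B).trans (mul_le_mul_of_nonneg_right hF (norm_nonneg B)),
   fun B => (h2 B).trans (mul_le_mul_of_nonneg_right hF (norm_nonneg B)), h3, fun z => (h4 z).trans hO⟩

/-- **a quantity is DOMINATED as soon as** the source is localised «y′ ∈ □_{ω_n}», obeys the last-factor bound (1.129) with a
constant below `κ.c_L·A·m₁`, and ONE admissible output functional reads it on `G src` («we estimate the norm … by the sum of
norms»). [cite: Balaban1984PropagatorsI, (1.129), (1.131) p.38] -/
theorem dominated_of_witness (G : Module.End ℝ V) (H : S → Module.End ℝ V) (Dg : V →ₗ[ℝ] Vg) (ctr : S → X) (c : ℝ)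
    (κ : SupConsts) {A s₁ m₁ : ℝ} (u u' : X) (src : V) {q L : ℝ}
    (hs : 0 ≤ s₁) (hm : 0 ≤ m₁) (hL : L ≤ κ.cL * A * m₁)
    (hloc : ∀ z : S, ¬ dist (ctr z) u' ≤ c → H z src = 0) (hsize : ∀ z : S, size Dg (G (H z src)) ≤ L)
    (D : V →ₗ[ℝ] ℝ) (hD : Adm G H ctr c κ A s₁ m₁ u src D) (hq : q ≤ ‖D (G src)‖) :
    Dominated G H Dg ctr c κ A s₁ m₁ u u' src q :=
  ⟨hs, hm, hloc, fun z => (hsize z).trans hL, fun _ _ h => hq.trans (h D hD)⟩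

/-- **the null problem** (value `0`, source `0`) is dominated. [cite: Balaban1984PropagatorsI, (1.131) p.38] -/
theorem dominated_zero (G : Module.End ℝ V) (H : S → Module.End ℝ V) (Dg : V →ₗ[ℝ] Vg) (ctr : S → X) (c : ℝ)
    (κ : SupConsts) {A s₁ m₁ : ℝ} (u u' : X) (hs : 0 ≤ s₁) (hm : 0 ≤ m₁) (hA : 0 ≤ A) :
    Dominated G H Dg ctr c κ A s₁ m₁ u u' (0 : V) 0 := by
  refine ⟨hs, hm, fun z _ => map_zero _, fun z => ?_, fun B hB _ => hB⟩
  rw [map_zero, map_zero]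
  unfold size
  rw [map_zero, norm_zero, norm_zero, add_zero]
  exact mul_nonneg (mul_nonneg κ.cL_nonneg hA) hm

omit [SeminormedAddCommGroup V] [Module ℝ V] [SeminormedAddCommGroup Vg] [Module ℝ Vg] [PseudoMetricSpace X] in
/-- `1 ≤ env`. [cite: Balaban1984PropagatorsI, pp.37–38] -/
theorem one_le_env (C a e e' ae : ℝ) : 1 ≤ env C a e e' ae := by
  unfold env; have := abs_nonneg C; have := abs_nonneg a; have := abs_nonneg e; have := abs_nonneg e'
  have := abs_nonneg ae; linarith

omit [SeminormedAddCommGroup V] [Module ℝ V] [SeminormedAddCommGroup Vg] [Module ℝ Vg] [PseudoMetricSpace X] in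
/-- `C + |C_α| + |C_ε| + |C_{α,ε}| ≤ env` (the factor estimates are linear in the (1.115)–(1.117) constants).
[cite: Balaban1984PropagatorsI, pp.37–38] -/
theorem le_env (C a e e' ae : ℝ) : C + |a| + |e| + |ae| ≤ env C a e e' ae := by
  unfold env; have := le_abs_self C; have := abs_nonneg e'; linarith

end Generic

/-! ## §2 Constants, functionals, localities -/

section Consts

/-- the `d`-only first-factor constant fed to `κ.c_F`. [cite: Balaban1984PropagatorsI, (1.125) p.38] -/
def cFmax (d : ℕ) : ℝ := cF3 d + cFH d + d * Lw d

/-- the `d`-only last-factor constant fed to `κ.c_L`. [cite: Balaban1984PropagatorsI, (1.129) p.38] -/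
def cLmax (d : ℕ) : ℝ := cLT d + cLA d

/-- the `d`-only one-factor constant fed to `κ.c₁`. [cite: Balaban1984PropagatorsI, (1.130) p.38] -/
def c1max (d : ℕ) : ℝ := c1H d + cF1 d * cLT d + (c1A d + 1 + d * Lw d) + cF3 d

/-- the members of `cFmax`. [cite: Balaban1984PropagatorsI, (1.125) p.38] -/
theorem le_cFmax : 1 ≤ cFmax d ∧ cF1 d ≤ cFmax d ∧ cF3 d ≤ cFmax d ∧ cFH d ≤ cFmax d ∧ 1 + d * Lw d ≤ cFmax d := by
  have h1 := one_le_cF3 (d := d); have h2 := one_le_cFH (d := d); have hL := Lw_nonneg d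
  have hd : (0 : ℝ) ≤ d := Nat.cast_nonneg d
  have hdL : 0 ≤ (d : ℝ) * Lw d := mul_nonneg hd hL
  have h3 : cF1 d ≤ cFH d := by
    unfold cF1 cFH; have := B5WalkLeibnizTorus.Kmix_nonneg; nlinarith
  unfold cFmax
  exact ⟨by linarith, by linarith, by linarith, by linarith, by linarith⟩

/-- the members of `cLmax`. [cite: Balaban1984PropagatorsI, (1.129) p.38] -/
theorem le_cLmax : 2 ≤ cLmax d ∧ cLT d ≤ cLmax d ∧ cLA d ≤ cLmax d := by
  have h1 := one_le_cLT (d := d); have h2 := two_le_cLA (d := d)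
  unfold cLmax
  exact ⟨by linarith, by linarith, by linarith⟩

/-- the members of `c1max`. [cite: Balaban1984PropagatorsI, (1.130) p.38] -/
theorem le_c1max : 1 ≤ c1max d ∧ cF1 d ≤ c1max d ∧ cF3 d ≤ c1max d ∧ cFH d ≤ c1max d ∧ cF1 d * cLT d ≤ c1max d ∧
    c1H d ≤ c1max d ∧ 1 + d * Lw d ≤ c1max d ∧ c1A d + 1 + d * Lw d ≤ c1max d := by
  have h1 := one_le_cF1 (d := d); have h3 := one_le_cF3 (d := d); have hH := one_le_cFH (d := d)
  have hT := one_le_cLT (d := d); have h1H := one_le_c1H (d := d); have hA := c1A_nonneg (d := d)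
  have hL := Lw_nonneg d
  have hd : (0 : ℝ) ≤ d := Nat.cast_nonneg d
  have hdL : 0 ≤ (d : ℝ) * Lw d := mul_nonneg hd hL
  have hFT : cF1 d ≤ cF1 d * cLT d := le_mul_of_one_le_right (by linarith) hT
  have hHle : cFH d ≤ c1H d := by
    unfold c1H; nlinarith
  unfold c1max
  exact ⟨by nlinarith, by nlinarith, by nlinarith, by nlinarith, by nlinarith, by nlinarith, by nlinarith, by nlinarith⟩

end Consts

section Functionals

variable {n : ℕ} [NeZero n] {M : Fin d → ℕ} [hM : ∀ μ, NeZero (M μ)] {a : ℝ} {M₀ : ℕ}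

/-- the output functional «`A ↦ A(b₀)`» of the entry `|GJ|`. [cite: Balaban1984PropagatorsI, (1.110) p.35] -/
def evL (n : ℕ) (M : Fin d → ℕ) (b₀ : Bnd n M) : VecR n M →ₗ[ℝ] ℝ := LinearMap.proj b₀

/-- the output functional «`A ↦ (∇_νA)(b₀)`» of the entries `|∇GJ|`, `|∇G∇*J|`. [cite: Balaban1984PropagatorsI, (1.110), (1.112) pp.35–36] -/
def gradL (n : ℕ) [NeZero n] (M : Fin d → ℕ) [∀ μ, NeZero (M μ)] (ν : Fin d) (b₀ : Bnd n M) : VecR n M →ₗ[ℝ] ℝ :=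
  (LinearMap.proj b₀).comp (Matrix.mulVecLin (fdiffR n M ν))

/-- the output functional «`A ↦ (ΔA)(b₀)`» of the entry `|ΔGJ|`. [cite: Balaban1984PropagatorsI, (1.110) p.35] -/
def lapL (n : ℕ) [NeZero n] (M : Fin d → ℕ) [∀ μ, NeZero (M μ)] (b₀ : Bnd n M) : VecR n M →ₗ[ℝ] ℝ :=
  (LinearMap.proj b₀).comp (Matrix.mulVecLin (LapR n M))

/-- the output functional «Hölder quotient of `ζ∇_νA` at the pair `((x,μ),(x′,μ))`» of (1.111), (1.113).
[cite: Balaban1984PropagatorsI, (1.111) p.35, (1.113) p.36, (1.109) p.35] -/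
def quotL (n : ℕ) [NeZero n] (M : Fin d → ℕ) [∀ μ, NeZero (M μ)] (α : ℝ) (ζ : Tor (fine n M) → ℝ) (ν μ : Fin d)
    (x x' : Tor (fine n M)) : VecR n M →ₗ[ℝ] ℝ :=
  (distU n M x x' ^ α)⁻¹ • (ζ x' • gradL n M ν (x', μ) - ζ x • gradL n M ν (x, μ))

/-- the output functional «`A ↦ ⟨∇A, T⟩`» of the ADJOINT problems (p. 39), on the `ℓ¹` carrier. [cite: Balaban1984PropagatorsI, p.39 L7–9] -/
def pairL (n : ℕ) [NeZero n] (M : Fin d → ℕ) [∀ μ, NeZero (M μ)] (T : Fin d → VecR n M) : V1 n M →ₗ[ℝ] ℝ where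
  toFun A := pair n M T (ofLp A)
  map_add' A B := by rw [WithLp.ofLp_add, pair_add]
  map_smul' c A := by rw [WithLp.ofLp_smul, pair_smul]; rfl

omit [NeZero n] hM in
/-- unfolding `evL`. [cite: Balaban1984PropagatorsI, (1.110) p.35] -/
@[simp] theorem evL_apply (b₀ : Bnd n M) (A : VecR n M) : evL n M b₀ A = A b₀ := rfl

/-- unfolding `gradL`. [cite: Balaban1984PropagatorsI, (1.110) p.35] -/
@[simp] theorem gradL_apply (ν : Fin d) (b₀ : Bnd n M) (A : VecR n M) : gradL n M ν b₀ A = gradR n M A ν b₀ := rfl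

/-- unfolding `lapL`. [cite: Balaban1984PropagatorsI, (1.110) p.35] -/
@[simp] theorem lapL_apply (b₀ : Bnd n M) (A : VecR n M) : lapL n M b₀ A = (LapR n M *ᵥ A) b₀ := rfl

/-- unfolding `quotL`. [cite: Balaban1984PropagatorsI, (1.111) p.35] -/
theorem quotL_apply (α : ℝ) (ζ : Tor (fine n M) → ℝ) (ν μ : Fin d) (x x' : Tor (fine n M)) (A : VecR n M) :
    quotL n M α ζ ν μ x x' A
      = (distU n M x x' ^ α)⁻¹ * (ζ x' * gradR n M A ν (x', μ) - ζ x * gradR n M A ν (x, μ)) := by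
  simp only [quotL, LinearMap.smul_apply, LinearMap.sub_apply, gradL_apply, smul_eq_mul]

/-- unfolding `pairL`. [cite: Balaban1984PropagatorsI, p.39 L7–9] -/
@[simp] theorem pairL_apply (T : Fin d → VecR n M) (A : V1 n M) : pairL n M T A = pair n M T (ofLp A) := rfl

/-- `Dgs = ∇` as a tensor. [cite: Balaban1984PropagatorsI, (1.108) p.35] -/
theorem Dgs_eq_gradR (W : VecR n M) : Dgs n M W = gradR n M W := funext fun ν => Dgs_apply W ν

/-- the size map of the direct carrier: `size Dgs W = |∇W| + |W|`. [cite: Balaban1984PropagatorsI, (1.129) p.38] -/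
theorem size_Dgs (W : VecR n M) : size (Dgs n M) W = ‖gradR n M W‖ + ‖W‖ := by
  unfold size; rw [Dgs_eq_gradR]

/-- the size map of the adjoint carrier: `size Dg1 w = ‖∇w‖₁ + ‖w‖₁`. [cite: Balaban1984PropagatorsI, (1.129) p.38, p.39 L7–9] -/
theorem size_Dg1 (w : V1 n M) : size (Dg1 n M) w = l1grad n M (ofLp w) + l1 n M (ofLp w) := by
  unfold size; rw [norm_Dg1_eq_l1grad, norm_V1_eq_l1]

omit [NeZero n] hM in
/-- unfolding `H1 z` through `ofLp`. [cite: Balaban1984PropagatorsI, (1.118) p.36] -/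
theorem ofLp_H1 (z : Cen M M₀) (w : V1 n M) : ofLp (H1 n M M₀ z w) = fun b => gz n M M₀ z b * ofLp w b := by
  funext b; rfl

/-- unfolding `G1 (H1 z w)` through `ofLp`. [cite: Balaban1984PropagatorsI, (1.123) p.37] -/
theorem ofLp_G1_H1 (z : Cen M M₀) (w : V1 n M) :
    ofLp (G1 n M a (H1 n M M₀ z w)) = GR n M a *ᵥ fun b => gz n M M₀ z b * ofLp w b := by
  rw [ofLp_G1, ofLp_H1]

end Functionals

section Locality

variable {n : ℕ} [NeZero n] {M : Fin d → ℕ} [hM : ∀ μ, NeZero (M μ)] {a : ℝ} {M₀ : ℕ} (κ : SupConsts)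

/-- the radius arithmetic: `r + ⅔M₀ ≤ c̄M₀` for `r ≤ 3`, `c̄ ≥ 11/3`, `M₀ ≥ 1`. [cite: Balaban1984PropagatorsI, p.38 («y ∈ □_{ω₀}, y′ ∈ □_{ω_n}»)] -/
theorem rad_le (hM₀ : 1 ≤ M₀) (hcb : 11 / 3 ≤ κ.cbar) {r : ℝ} (hr : r ≤ 3) : r + 2 / 3 * M₀ ≤ κ.cbar * M₀ := by
  have hM1 : (1 : ℝ) ≤ M₀ := by exact_mod_cast hM₀
  nlinarith

omit [NeZero n] in
/-- **`h_z` VANISHES FAR FROM ITS CUBE**: if the fine site of `c` is within `r ≤ 3` of `u` and `□_z`՚s centre is farther than `c̄M₀`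
from `u`, then `h_z(c) = 0` («h ∈ C₀^∞(]−⅔,⅔[)», cubes of size `2M₀`). [cite: Balaban1984PropagatorsI, (1.118) p.36, p.38] -/
theorem gz_eq_zero_of_far (hM₀ : 1 ≤ M₀) (hcb : 11 / 3 ≤ κ.cbar) {z : Cen M M₀} {c : Bnd n M} {u : TorR M} {r : ℝ}
    (hr : r ≤ 3) (hu : dist (ucPt M n c.1) u ≤ r) (hfar : ¬ dist u (ctr M M₀ z) ≤ κ.cbar * M₀) :
    gz n M M₀ z c = 0 := by
  by_contra h
  apply hfar
  have d1 : dist (ucPt M n c.1) (ctr M M₀ z) ≤ 2 / 3 * M₀ := dist_ctr_le_of_hz_ne_zero M hM₀ h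
  rw [dist_comm] at hu
  calc dist u (ctr M M₀ z) ≤ dist u (ucPt M n c.1) + dist (ucPt M n c.1) (ctr M M₀ z) := dist_triangle _ _ _
    _ ≤ r + 2 / 3 * M₀ := add_le_add hu d1
    _ ≤ κ.cbar * M₀ := rad_le κ hM₀ hcb hr

/-- a fine site one matrix element of `∇_ν` away from a site within `1` of `u` is within `2` of `u`. [cite: Balaban1984PropagatorsI, (1.31) p.23] -/
theorem dist_le_two_of_fdiffR (hn : 1 ≤ n) {ν : Fin d} {b j : Bnd n M} {u : TorR M} (hb : dist (ucPt M n b.1) u ≤ 1)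
    (hf : fdiffR n M ν b j ≠ 0) : dist (ucPt M n j.1) u ≤ 2 := by
  have h1 : distU n M b.1 j.1 ≤ 1 := (distU_le_of_fdiffR_ne_zero hf).trans (by
    rw [div_le_iff₀ (by exact_mod_cast (show 0 < n by omega))]; simp only [one_mul]; exact_mod_cast hn)
  have h2 : dist (ucPt M n j.1) (ucPt M n b.1) ≤ 1 := by
    rw [dist_comm]; exact (dist_ucPt_le_distU M n hn _ _).trans h1
  linarith [dist_triangle (ucPt M n j.1) (ucPt M n b.1) u]

/-- LOCALITY OF THE EVALUATION at `b₀ ∈ Δ̃(y)`: `ev_{b₀} ∘ h_z = 0` unless `dist(y, ctr z) ≤ c̄M₀` («y ∈ □_{ω₀}»).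
[cite: Balaban1984PropagatorsI, p.38, (1.118) p.36] -/
theorem evL_comp_Hs (hn : 1 ≤ n) (hM₀ : 1 ≤ M₀) (hcb : 11 / 3 ≤ κ.cbar) {b₀ : Bnd n M} {y : Tor M}
    (hb₀ : b₀.1 ∈ cubeT n M y) (z : Cen M M₀) (hfar : ¬ dist (sitePt M y) (ctr M M₀ z) ≤ κ.cbar * M₀) :
    evL n M b₀ ∘ₗ Hs n M M₀ z = 0 := by
  apply LinearMap.ext; intro v
  rw [LinearMap.comp_apply, evL_apply, LinearMap.zero_apply, Hs_apply]
  have hg : gz n M M₀ z b₀ = 0 :=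
    gz_eq_zero_of_far κ hM₀ hcb (by norm_num) (dist_ucPt_sitePt_le_one M n hn hb₀) hfar
  rw [show hz M M₀ z (ucPt M n b₀.1) = gz n M M₀ z b₀ from rfl, hg, zero_mul]

/-- LOCALITY OF THE GRADIENT ENTRY at `b₀ ∈ Δ̃(y)`. [cite: Balaban1984PropagatorsI, p.38, (1.118) p.36, (1.31) p.23] -/
theorem gradL_comp_Hs (hn : 1 ≤ n) (hM₀ : 1 ≤ M₀) (hcb : 11 / 3 ≤ κ.cbar) (ν : Fin d) {b₀ : Bnd n M} {y : Tor M}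
    (hb₀ : b₀.1 ∈ cubeT n M y) (z : Cen M M₀) (hfar : ¬ dist (sitePt M y) (ctr M M₀ z) ≤ κ.cbar * M₀) :
    gradL n M ν b₀ ∘ₗ Hs n M M₀ z = 0 := by
  apply LinearMap.ext; intro v
  rw [LinearMap.comp_apply, gradL_apply, LinearMap.zero_apply, Hs_eq_fun]
  simp only [gradR, Matrix.mulVec, dotProduct]
  refine Finset.sum_eq_zero fun j _ => ?_
  by_cases hf : fdiffR n M ν b₀ j = 0
  · rw [hf, zero_mul]
  · have hj : dist (ucPt M n j.1) (sitePt M y) ≤ 2 := dist_le_two_of_fdiffR hn (dist_ucPt_sitePt_le_one M n hn hb₀) hf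
    rw [gz_eq_zero_of_far κ hM₀ hcb (by norm_num) hj hfar, zero_mul, mul_zero]

/-- LOCALITY OF THE LAPLACIAN ENTRY at `b₀ ∈ Δ̃(y)`. [cite: Balaban1984PropagatorsI, p.38, (1.118) p.36, (1.21) p.21] -/
theorem lapL_comp_Hs (hn : 1 ≤ n) (hM₀ : 1 ≤ M₀) (hcb : 11 / 3 ≤ κ.cbar) {b₀ : Bnd n M} {y : Tor M}
    (hb₀ : b₀.1 ∈ cubeT n M y) (z : Cen M M₀) (hfar : ¬ dist (sitePt M y) (ctr M M₀ z) ≤ κ.cbar * M₀) :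
    lapL n M b₀ ∘ₗ Hs n M M₀ z = 0 := by
  apply LinearMap.ext; intro v
  rw [LinearMap.comp_apply, lapL_apply, LinearMap.zero_apply, Hs_eq_fun]
  simp only [Matrix.mulVec, dotProduct]
  refine Finset.sum_eq_zero fun j _ => ?_
  by_cases hf : LapR n M b₀ j = 0
  · rw [hf, zero_mul]
  · have h1 : distU n M b₀.1 j.1 ≤ 2 := (distU_le_of_LapR_ne_zero hf).trans (two_div_le_two hn)
    have h2 : dist (ucPt M n j.1) (ucPt M n b₀.1) ≤ 2 := by
      rw [dist_comm]; exact (dist_ucPt_le_distU M n hn _ _).trans h1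
    have hj : dist (ucPt M n j.1) (sitePt M y) ≤ 3 := by
      linarith [dist_triangle (ucPt M n j.1) (ucPt M n b₀.1) (sitePt M y), dist_ucPt_sitePt_le_one M n hn hb₀]
    rw [gz_eq_zero_of_far κ hM₀ hcb le_rfl hj hfar, zero_mul, mul_zero]

/-- LOCALITY OF THE `ζ`-HÖLDER QUOTIENT, `supp ζ ⊂ Δ̃(y)`. [cite: Balaban1984PropagatorsI, p.38, (1.111) p.35, (1.118) p.36] -/
theorem quotL_comp_Hs (hn : 1 ≤ n) (hM₀ : 1 ≤ M₀) (hcb : 11 / 3 ≤ κ.cbar) (α : ℝ) {ζ : Tor (fine n M) → ℝ} {y : Tor M}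
    (hζ : cutInL n M ζ y) (ν μ : Fin d) (x x' : Tor (fine n M)) (z : Cen M M₀)
    (hfar : ¬ dist (sitePt M y) (ctr M M₀ z) ≤ κ.cbar * M₀) : quotL n M α ζ ν μ x x' ∘ₗ Hs n M M₀ z = 0 := by
  have hx : ∀ (x₀ : Tor (fine n M)) (v : VecR n M), ζ x₀ * gradR n M (Hs n M M₀ z v) ν (x₀, μ) = 0 := by
    intro x₀ v
    by_cases h0 : ζ x₀ = 0
    · rw [h0, zero_mul]
    · have h := congrArg (fun f => f v) (gradL_comp_Hs κ hn hM₀ hcb ν (b₀ := (x₀, μ)) (hζ x₀ h0) z hfar)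
      simp only [LinearMap.comp_apply, gradL_apply, LinearMap.zero_apply] at h
      rw [h, mul_zero]
  apply LinearMap.ext; intro v
  rw [LinearMap.comp_apply, quotL_apply, LinearMap.zero_apply, hx x' v, hx x v, sub_zero, mul_zero]

/-- LOCALITY OF THE ADJOINT OUTPUT `⟨∇·, T⟩`, `supp T ⊂ Δ̃(y′)`: `⟨∇(h_zA), T⟩ = 0` unless `dist(y′, ctr z) ≤ c̄M₀`.
[cite: Balaban1984PropagatorsI, p.38–39, (1.118) p.36] -/
theorem pairL_comp_H1 (hn : 1 ≤ n) (hM₀ : 1 ≤ M₀) (hcb : 11 / 3 ≤ κ.cbar) {T : Fin d → VecR n M} {y' : Tor M}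
    (hT : ∀ ν c, T ν c ≠ 0 → c.1 ∈ cubeT n M y') (z : Cen M M₀) (hfar : ¬ dist (sitePt M y') (ctr M M₀ z) ≤ κ.cbar * M₀) :
    pairL n M T ∘ₗ H1 n M M₀ z = 0 := by
  apply LinearMap.ext; intro A
  rw [LinearMap.comp_apply, pairL_apply, LinearMap.zero_apply, ofLp_H1]
  unfold pair
  refine Finset.sum_eq_zero fun ν _ => Finset.sum_eq_zero fun c _ => ?_
  by_cases h0 : T ν c = 0
  · rw [h0, mul_zero]
  · have h := congrArg (fun f => f (ofLp A)) (gradL_comp_Hs κ hn hM₀ hcb ν (hT ν c h0) z hfar)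
    simp only [LinearMap.comp_apply, gradL_apply, LinearMap.zero_apply, Hs_eq_fun] at h
    rw [h, zero_mul]

/-- SOURCE LOCALITY, vector source `supp J ⊂ Δ̃(y′)`: `h_zJ = 0` unless `dist(ctr z, y′) ≤ c̄M₀` («y′ ∈ □_{ω_n}»).
[cite: Balaban1984PropagatorsI, p.38, (1.118) p.36] -/
theorem Hs_src_eq_zero (hn : 1 ≤ n) (hM₀ : 1 ≤ M₀) (hcb : 11 / 3 ≤ κ.cbar) {J : VecR n M} {y' : Tor M}
    (hJ : ∀ c, J c ≠ 0 → c.1 ∈ cubeT n M y') (z : Cen M M₀) (hfar : ¬ dist (ctr M M₀ z) (sitePt M y') ≤ κ.cbar * M₀) :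
    Hs n M M₀ z J = 0 := by
  rw [dist_comm] at hfar
  rw [Hs_eq_fun]
  funext c
  by_cases h0 : J c = 0
  · rw [h0, mul_zero]; rfl
  · rw [gz_eq_zero_of_far κ hM₀ hcb (by norm_num) (dist_ucPt_sitePt_le_one M n hn (hJ c h0)) hfar, zero_mul]; rfl

/-- SOURCE LOCALITY, tensor source `supp T ⊂ Δ̃(y′)`: `h_z∇*T = 0` unless `dist(ctr z, y′) ≤ c̄M₀`.
[cite: Balaban1984PropagatorsI, p.38, (1.118) p.36, (1.31) p.23] -/
theorem Hs_divTR_eq_zero (hn : 1 ≤ n) (hM₀ : 1 ≤ M₀) (hcb : 11 / 3 ≤ κ.cbar) {T : Fin d → VecR n M} {y' : Tor M}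
    (hT : ∀ ν c, T ν c ≠ 0 → c.1 ∈ cubeT n M y') (z : Cen M M₀) (hfar : ¬ dist (ctr M M₀ z) (sitePt M y') ≤ κ.cbar * M₀) :
    Hs n M M₀ z (divTR n M T) = 0 := by
  rw [dist_comm] at hfar
  rw [Hs_eq_fun]
  funext c
  show gz n M M₀ z c * divTR n M T c = 0
  by_cases hg : gz n M M₀ z c = 0
  · rw [hg, zero_mul]
  · rw [B5SupCarrierTorus.divTR_apply]
    have : ∑ ν, ∑ b, fdiffR n M ν b c * T ν b = 0 := by
      refine Finset.sum_eq_zero fun ν _ => Finset.sum_eq_zero fun b _ => ?_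
      by_cases h0 : T ν b = 0
      · rw [h0, mul_zero]
      by_cases hf : fdiffR n M ν b c = 0
      · rw [hf, zero_mul]
      exact absurd (gz_eq_zero_of_far κ hM₀ hcb (by norm_num)
        (dist_le_two_of_fdiffR hn (dist_ucPt_sitePt_le_one M n hn (hT ν b h0)) hf) hfar) hg
    rw [this, mul_zero]

/-- SOURCE LOCALITY on the `ℓ¹` carrier for a real source supported in `Δ̃(y)`. [cite: Balaban1984PropagatorsI, p.38–39, (1.118) p.36] -/
theorem H1_src_eq_zero (hn : 1 ≤ n) (hM₀ : 1 ≤ M₀) (hcb : 11 / 3 ≤ κ.cbar) {v : VecR n M} {y : Tor M}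
    (hv : ∀ c, v c ≠ 0 → c.1 ∈ cubeT n M y) (z : Cen M M₀) (hfar : ¬ dist (ctr M M₀ z) (sitePt M y) ≤ κ.cbar * M₀) :
    H1 n M M₀ z (toLp 1 v) = 0 := by
  have h := Hs_src_eq_zero κ hn hM₀ hcb hv z hfar
  rw [Hs_eq_fun] at h
  ext c
  have hc := congrFun h c
  simp only [Pi.zero_apply] at hc
  rw [H1_apply]
  show gz n M M₀ z c * v c = 0
  exact hc

end Locality

/-! ## §3 The direct problems are dominated -/

section Direct

variable {n : ℕ} [NeZero n] {M : Fin d → ℕ} [hM : ∀ μ, NeZero (M μ)] {a : ℝ} {M₀ : ℕ} (k : ℕ) (κ : SupConsts)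
  {C : ℝ} {Cα Cε : ℝ → ℝ} {Cαε : ℝ → ℝ → ℝ}

/-- `Hs z (Gs B)` as a function. [cite: Balaban1984PropagatorsI, (1.123) p.37] -/
theorem Hs_Gs_eq (z : Cen M M₀) (B : VecR n M) :
    Hs n M M₀ z (Gs n M a B) = fun b => gz n M M₀ z b * (GR n M a *ᵥ B) b := by
  rw [Hs_eq_fun, Gs_apply]

/-- `Hs z (Gs (Hs z J))` as a function. [cite: Balaban1984PropagatorsI, (1.130) p.38] -/
theorem Hs_Gs_Hs_eq (z : Cen M M₀) (J : VecR n M) :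
    Hs n M M₀ z (Gs n M a (Hs n M M₀ z J)) = fun b => gz n M M₀ z b * (GR n M a *ᵥ fun b' => gz n M M₀ z b' * J b') b := by
  rw [Hs_Gs_eq, Hs_eq_fun]

/-- the size of the vector source: `|∇Gh_zJ| + |Gh_zJ| ≤ 2C|J|`. [cite: Balaban1984PropagatorsI, (1.129) p.38, (1.115) p.36] -/
theorem size_vec_le (hn : 1 ≤ n) (hC : 0 ≤ C)
    (hG : B5.Global115_117 (latticeSettingP12R n M a k) (gP12R M n a k) C Cα Cε Cαε) (z : Cen M M₀) (J : VecR n M) :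
    size (Dgs n M) (Gs n M a (Hs n M M₀ z J)) ≤ 2 * C * ‖J‖ := by
  rw [size_Dgs, Gs_apply, Hs_eq_fun]
  exact last_vec_le k hn hC hG z J

/-- the size of the tensor source: `|∇Gh_z∇*T| + |Gh_z∇*T| ≤ cLT·(C + |C_ε(ε)|)(‖T‖_ε + |T|)` — (1.129).
[cite: Balaban1984PropagatorsI, (1.129) p.38, (1.115), (1.116) p.36] -/
theorem size_ten_le (hn : 1 ≤ n) (hM₀ : 1 ≤ M₀) (hC : 0 ≤ C)
    (hG : B5.Global115_117 (latticeSettingP12R n M a k) (gP12R M n a k) C Cα Cε Cαε) (z : Cen M M₀)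
    (T : Fin d → VecR n M) {ε : ℝ} (hε0 : 0 < ε) (hε1 : ε < 1) :
    size (Dgs n M) (Gs n M a (Hs n M M₀ z (divTR n M T)))
      ≤ cLT d * (C + |Cε ε|) * (holderT n M ε (fun ν => cplx (T ν)) + ‖T‖) := by
  rw [size_Dgs, Gs_apply, Hs_eq_fun]
  exact last_ten_le k hn hM₀ hC hG z T hε0 hε1

/-- **(1.110), `m = 0`: THE POINT VALUE `|(GJ)(b₀)|`, `b₀ ∈ Δ̃(y)`, `supp J ⊂ Δ̃(y′)`, IS DOMINATED** (direct walk; envelope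
`env C 0 0 0 0`, sizes `1`, `|J|`). [cite: Balaban1984PropagatorsI, (1.110) p.35, (1.123) p.37, (1.125), (1.129)–(1.131) p.38] -/
theorem dominated_eval (hn : 1 ≤ n) (hM₀ : 1 ≤ M₀) (hC : 0 < C)
    (hG : B5.Global115_117 (latticeSettingP12R n M a k) (gP12R M n a k) C Cα Cε Cαε)
    (hcb : 11 / 3 ≤ κ.cbar) (hcF : cFmax d ≤ κ.cF) (hcL : cLmax d ≤ κ.cL) (hc1 : c1max d ≤ κ.c1)
    {J : VecR n M} {y y' : Tor M} (hJ : ∀ c, J c ≠ 0 → c.1 ∈ cubeT n M y') {b₀ : Bnd n M} (hb₀ : b₀.1 ∈ cubeT n M y) :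
    Dominated (Gs n M a) (Hs n M M₀) (Dgs n M) (ctr M M₀) (κ.cbar * M₀) κ (env C 0 0 0 0) 1 ‖J‖
      (sitePt M y) (sitePt M y') J |(GR n M a *ᵥ J) b₀| := by
  have hA1 := one_le_env C 0 0 0 0
  have hCA : C ≤ env C 0 0 0 0 := by have := le_env C 0 0 0 0; simp only [abs_zero, add_zero] at this; exact this
  have hJ0 := norm_nonneg J
  obtain ⟨hF1, -, -, -, -⟩ := le_cFmax (d := d)
  obtain ⟨hL2, -, -⟩ := le_cLmax (d := d)
  obtain ⟨h11, -⟩ := le_c1max (d := d)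
  refine dominated_of_witness _ _ _ _ _ κ _ _ J zero_le_one hJ0 ?_ (Hs_src_eq_zero κ hn hM₀ hcb hJ)
    (fun z => size_vec_le k hn hC.le hG z J) (evL n M b₀) ?_ ?_
  · have : 2 * C ≤ κ.cL * env C 0 0 0 0 := by nlinarith [κ.cL_nonneg]
    nlinarith
  · refine adm_of_bounds _ _ _ _ κ _ J _ (F := C) (O := C * ‖J‖) ?_ ?_ ?_ ?_ (evL_comp_Hs κ hn hM₀ hcb hb₀) ?_
    · have : C ≤ κ.cF * env C 0 0 0 0 := by nlinarith [κ.cF_nonneg]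
      linarith
    · have : C ≤ κ.c1 * env C 0 0 0 0 := by nlinarith [κ.c1_nonneg]
      nlinarith
    · intro z B; rw [evL_apply, Hs_Gs_eq, Real.norm_eq_abs]; exact abs_gz_G_le k hn hC.le hG z B b₀
    · intro B; rw [evL_apply, Gs_apply, Real.norm_eq_abs]; exact abs_G_le k hn hC.le hG B b₀
    · intro z; rw [evL_apply, Hs_Gs_Hs_eq, Real.norm_eq_abs]; exact one_eval_vec_le k hn hC.le hG z J b₀
  · rw [evL_apply, Gs_apply, Real.norm_eq_abs]

/-- **(1.110), `m = 1`: THE POINT VALUE `|(∇_νGJ)(b₀)|` IS DOMINATED** (direct walk). [cite: Balaban1984PropagatorsI, (1.110) p.35, (1.125), (1.129)–(1.131) p.38] -/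
theorem dominated_grad (hn : 1 ≤ n) (hM₀ : 1 ≤ M₀) (hC : 0 < C)
    (hG : B5.Global115_117 (latticeSettingP12R n M a k) (gP12R M n a k) C Cα Cε Cαε)
    (hcb : 11 / 3 ≤ κ.cbar) (hcF : cFmax d ≤ κ.cF) (hcL : cLmax d ≤ κ.cL) (hc1 : c1max d ≤ κ.c1)
    {J : VecR n M} {y y' : Tor M} (hJ : ∀ c, J c ≠ 0 → c.1 ∈ cubeT n M y') (ν : Fin d) {b₀ : Bnd n M}
    (hb₀ : b₀.1 ∈ cubeT n M y) :
    Dominated (Gs n M a) (Hs n M M₀) (Dgs n M) (ctr M M₀) (κ.cbar * M₀) κ (env C 0 0 0 0) 1 ‖J‖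
      (sitePt M y) (sitePt M y') J |gradR n M (GR n M a *ᵥ J) ν b₀| := by
  have hA1 := one_le_env C 0 0 0 0
  have hCA : C ≤ env C 0 0 0 0 := by have := le_env C 0 0 0 0; simp only [abs_zero, add_zero] at this; exact this
  have hJ0 := norm_nonneg J
  obtain ⟨-, hF1, -, -, -⟩ := le_cFmax (d := d)
  obtain ⟨hL2, -, -⟩ := le_cLmax (d := d)
  obtain ⟨-, h11, -⟩ := le_c1max (d := d)
  have hcF1 := one_le_cF1 (d := d)
  refine dominated_of_witness _ _ _ _ _ κ _ _ J zero_le_one hJ0 ?_ (Hs_src_eq_zero κ hn hM₀ hcb hJ)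
    (fun z => size_vec_le k hn hC.le hG z J) (gradL n M ν b₀) ?_ ?_
  · have : 2 * C ≤ κ.cL * env C 0 0 0 0 := by nlinarith [κ.cL_nonneg]
    nlinarith
  · refine adm_of_bounds _ _ _ _ κ _ J _ (F := cF1 d * C) (O := cF1 d * C * ‖J‖) ?_ ?_ ?_ ?_
      (gradL_comp_Hs κ hn hM₀ hcb ν hb₀) ?_
    · have : cF1 d * C ≤ κ.cF * env C 0 0 0 0 := by nlinarith [κ.cF_nonneg]
      linarith
    · have : cF1 d * C ≤ κ.c1 * env C 0 0 0 0 := by nlinarith [κ.c1_nonneg]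
      nlinarith
    · intro z B; rw [gradL_apply, Hs_Gs_eq, Real.norm_eq_abs]; exact abs_gradR_gz_G_le k hn hM₀ hC.le hG z B ν b₀
    · intro B; rw [gradL_apply, Gs_apply, Real.norm_eq_abs]
      exact (abs_gradR_G_le k hn hC.le hG B ν b₀).trans (by rw [mul_assoc]; exact le_mul_of_one_le_left (mul_nonneg hC.le (norm_nonneg B)) hcF1)
    · intro z; rw [gradL_apply, Hs_Gs_Hs_eq, Real.norm_eq_abs]; exact one_grad_vec_le k hn hM₀ hC.le hG z J ν b₀
  · rw [gradL_apply, Gs_apply, Real.norm_eq_abs]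

/-- **(1.110), `m = 3`: THE POINT VALUE `|(ΔGJ)(b₀)|` IS DOMINATED** (direct walk). [cite: Balaban1984PropagatorsI, (1.110) p.35, (1.125), (1.129)–(1.131) p.38] -/
theorem dominated_lap (hn : 1 ≤ n) (hM₀ : 1 ≤ M₀) (hC : 0 < C)
    (hG : B5.Global115_117 (latticeSettingP12R n M a k) (gP12R M n a k) C Cα Cε Cαε)
    (hcb : 11 / 3 ≤ κ.cbar) (hcF : cFmax d ≤ κ.cF) (hcL : cLmax d ≤ κ.cL) (hc1 : c1max d ≤ κ.c1)
    {J : VecR n M} {y y' : Tor M} (hJ : ∀ c, J c ≠ 0 → c.1 ∈ cubeT n M y') {b₀ : Bnd n M} (hb₀ : b₀.1 ∈ cubeT n M y) :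
    Dominated (Gs n M a) (Hs n M M₀) (Dgs n M) (ctr M M₀) (κ.cbar * M₀) κ (env C 0 0 0 0) 1 ‖J‖
      (sitePt M y) (sitePt M y') J |(LapR n M *ᵥ (GR n M a *ᵥ J)) b₀| := by
  have hA1 := one_le_env C 0 0 0 0
  have hCA : C ≤ env C 0 0 0 0 := by have := le_env C 0 0 0 0; simp only [abs_zero, add_zero] at this; exact this
  have hJ0 := norm_nonneg J
  obtain ⟨-, -, hF3, -, -⟩ := le_cFmax (d := d)
  obtain ⟨hL2, -, -⟩ := le_cLmax (d := d)
  obtain ⟨-, -, h13, -⟩ := le_c1max (d := d)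
  have hcF3 := one_le_cF3 (d := d)
  refine dominated_of_witness _ _ _ _ _ κ _ _ J zero_le_one hJ0 ?_ (Hs_src_eq_zero κ hn hM₀ hcb hJ)
    (fun z => size_vec_le k hn hC.le hG z J) (lapL n M b₀) ?_ ?_
  · have : 2 * C ≤ κ.cL * env C 0 0 0 0 := by nlinarith [κ.cL_nonneg]
    nlinarith
  · refine adm_of_bounds _ _ _ _ κ _ J _ (F := cF3 d * C) (O := cF3 d * C * ‖J‖) ?_ ?_ ?_ ?_
      (lapL_comp_Hs κ hn hM₀ hcb hb₀) ?_
    · have : cF3 d * C ≤ κ.cF * env C 0 0 0 0 := by nlinarith [κ.cF_nonneg]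
      linarith
    · have : cF3 d * C ≤ κ.c1 * env C 0 0 0 0 := by nlinarith [κ.c1_nonneg]
      nlinarith
    · intro z B; rw [lapL_apply, Hs_Gs_eq, Real.norm_eq_abs]; exact abs_LapR_gz_G_le k hn hM₀ hC.le hG z B b₀
    · intro B; rw [lapL_apply, Gs_apply, Real.norm_eq_abs]
      exact (abs_LapR_G_le_of_global k hn hC.le hG B b₀).trans (by rw [mul_assoc]; exact le_mul_of_one_le_left (mul_nonneg hC.le (norm_nonneg B)) hcF3)
    · intro z; rw [lapL_apply, Hs_Gs_Hs_eq, Real.norm_eq_abs]; exact one_Lap_vec_le k hn hM₀ hC.le hG z J b₀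
  · rw [lapL_apply, Gs_apply, Real.norm_eq_abs]

/-- `|t^{−α}·X| = (t^α)⁻¹|X|` for `t > 0`. [cite: Balaban1984PropagatorsI, (1.109) p.35] -/
theorem abs_inv_rpow_mul {t : ℝ} (ht : 0 < t) (α X : ℝ) : |(t ^ α)⁻¹ * X| = (t ^ α)⁻¹ * |X| := by
  rw [abs_mul, abs_of_pos (inv_pos.mpr (Real.rpow_pos_of_pos ht α))]

/-- `(t^α)⁻¹·(K·t^α) = K`. [cite: Balaban1984PropagatorsI, (1.109) p.35] -/
theorem inv_rpow_mul_cancel {t : ℝ} (ht : 0 < t) (α K : ℝ) : (t ^ α)⁻¹ * (K * t ^ α) = K := by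
  have h := (Real.rpow_pos_of_pos ht α).ne'
  field_simp

/-- **(1.111), vector summand: THE HÖLDER QUOTIENT OF `ζ∇GJ` AT AN ADMISSIBLE PAIR IS DOMINATED** (direct walk; envelope
`env C (C_α α) 0 0 0`, sizes `‖ζ‖_α + |ζ|`, `|J|`). [cite: Balaban1984PropagatorsI, (1.111) p.35, (1.125) p.38, (1.129)–(1.131) p.38] -/
theorem dominated_quotH_vec (hn : 1 ≤ n) (hM₀ : 1 ≤ M₀) (hC : 0 < C)
    (hG : B5.Global115_117 (latticeSettingP12R n M a k) (gP12R M n a k) C Cα Cε Cαε)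
    (hcb : 11 / 3 ≤ κ.cbar) (hcF : cFmax d ≤ κ.cF) (hcL : cLmax d ≤ κ.cL) (hc1 : c1max d ≤ κ.c1)
    {J : VecR n M} {y y' : Tor M} (hJ : ∀ c, J c ≠ 0 → c.1 ∈ cubeT n M y') {α : ℝ} (hα0 : 0 ≤ α) (hα1 : α < 1)
    {ζ : Tor (fine n M) → ℝ} (hζ : cutInL n M ζ y) (ν μ : Fin d) {x x' : Tor (fine n M)}
    (h1 : distU n M x x' ≤ 1) (h0 : 0 < distU n M x x') :
    Dominated (Gs n M a) (Hs n M M₀) (Dgs n M) (ctr M M₀) (κ.cbar * M₀) κ (env C (Cα α) 0 0 0)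
      (cutHL n M α ζ) ‖J‖ (sitePt M y) (sitePt M y') J
      ((distU n M x x' ^ α)⁻¹ * |ζ x' * gradR n M (GR n M a *ᵥ J) ν (x', μ) - ζ x * gradR n M (GR n M a *ᵥ J) ν (x, μ)|) := by
  have hA1 := one_le_env C (Cα α) 0 0 0
  have hCA : C + |Cα α| ≤ env C (Cα α) 0 0 0 := by
    have := le_env C (Cα α) 0 0 0; simp only [abs_zero, add_zero] at this; exact this
  have hCa := abs_nonneg (Cα α)
  have hJ0 := norm_nonneg J
  have hs : 0 ≤ cutHL n M α ζ := B5Prop12FieldsLattice.cutHL_nonneg α ζ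
  obtain ⟨-, -, -, hFH, -⟩ := le_cFmax (d := d)
  obtain ⟨hL2, -, -⟩ := le_cLmax (d := d)
  obtain ⟨-, -, -, h1H, -⟩ := le_c1max (d := d)
  have hcFH := one_le_cFH (d := d)
  rw [cutHL_eq] at hs ⊢
  refine dominated_of_witness _ _ _ _ _ κ _ _ J hs hJ0 ?_ (Hs_src_eq_zero κ hn hM₀ hcb hJ)
    (fun z => size_vec_le k hn hC.le hG z J) (quotL n M α ζ ν μ x x') ?_ ?_
  · have : 2 * C ≤ κ.cL * env C (Cα α) 0 0 0 := by nlinarith [κ.cL_nonneg]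
    nlinarith
  · refine adm_of_bounds _ _ _ _ κ _ J _ (F := cFH d * (C + |Cα α|) * (holS n M α ζ + cutSupL n M ζ))
      (O := cFH d * (C + |Cα α|) * (holS n M α ζ + cutSupL n M ζ) * ‖J‖) ?_ ?_ ?_ ?_
      (quotL_comp_Hs κ hn hM₀ hcb α hζ ν μ x x') ?_
    · have : cFH d * (C + |Cα α|) ≤ κ.cF * env C (Cα α) 0 0 0 :=
        mul_le_mul (hFH.trans hcF) hCA (by linarith) κ.cF_nonneg
      exact mul_le_mul_of_nonneg_right this hs
    · have : cFH d * (C + |Cα α|) ≤ κ.c1 * env C (Cα α) 0 0 0 :=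
        mul_le_mul (h1H.trans hc1) hCA (by linarith) κ.c1_nonneg
      exact mul_le_mul_of_nonneg_right (mul_le_mul_of_nonneg_right this hs) hJ0
    · intro z B
      rw [quotL_apply, Hs_Gs_eq, Real.norm_eq_abs, abs_inv_rpow_mul h0]
      calc (distU n M x x' ^ α)⁻¹ * _ ≤ (distU n M x x' ^ α)⁻¹
            * (cFH d * (C + |Cα α|) * (holS n M α ζ + cutSupL n M ζ) * ‖B‖ * distU n M x x' ^ α) :=
            mul_le_mul_of_nonneg_left (quotH_gz_G_le k hn hM₀ hC.le hG z B hα0 hα1 ζ ν μ h1 h0)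
              (inv_nonneg.mpr (Real.rpow_nonneg h0.le α))
        _ = _ := inv_rpow_mul_cancel h0 α _
    · intro B
      rw [quotL_apply, Gs_apply, Real.norm_eq_abs, abs_inv_rpow_mul h0]
      calc (distU n M x x' ^ α)⁻¹ * _ ≤ (distU n M x x' ^ α)⁻¹
            * ((C + |Cα α|) * (holS n M α ζ + cutSupL n M ζ) * ‖B‖ * distU n M x x' ^ α) :=
            mul_le_mul_of_nonneg_left (quotH_G_le k hn hC.le hG B hα0 hα1 ζ ν μ h1 h0)
              (inv_nonneg.mpr (Real.rpow_nonneg h0.le α))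
        _ = (C + |Cα α|) * (holS n M α ζ + cutSupL n M ζ) * ‖B‖ := inv_rpow_mul_cancel h0 α _
        _ ≤ _ := by
            have : (C + |Cα α|) * (holS n M α ζ + cutSupL n M ζ) ≤ cFH d * (C + |Cα α|) * (holS n M α ζ + cutSupL n M ζ) := by
              have h' : (C + |Cα α|) ≤ cFH d * (C + |Cα α|) := le_mul_of_one_le_left (by linarith) hcFH
              exact mul_le_mul_of_nonneg_right h' hs
            exact mul_le_mul_of_nonneg_right this (norm_nonneg B)
    · intro z
      rw [quotL_apply, Hs_Gs_Hs_eq, Real.norm_eq_abs, abs_inv_rpow_mul h0]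
      calc (distU n M x x' ^ α)⁻¹ * _ ≤ (distU n M x x' ^ α)⁻¹
            * (cFH d * (C + |Cα α|) * (holS n M α ζ + cutSupL n M ζ) * ‖J‖ * distU n M x x' ^ α) :=
            mul_le_mul_of_nonneg_left (one_quotH_vec_le k hn hM₀ hC.le hG z J hα0 hα1 ζ ν μ h1 h0)
              (inv_nonneg.mpr (Real.rpow_nonneg h0.le α))
        _ = _ := inv_rpow_mul_cancel h0 α _
  · rw [quotL_apply, Gs_apply, Real.norm_eq_abs, abs_inv_rpow_mul h0]

/-- **(1.112): THE POINT VALUE `|(∇_νG∇*T)(b₀)|` IS DOMINATED** (direct walk, tensor source `∇*T`; envelope `env C 0 (C_ε ε) 0 0`,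
sizes `1`, `‖T‖_ε + |T|`). [cite: Balaban1984PropagatorsI, (1.112) p.36, (1.125) p.38, (1.129)–(1.131) p.38] -/
theorem dominated_grad_ten (hn : 1 ≤ n) (hM₀ : 1 ≤ M₀) (hC : 0 < C)
    (hG : B5.Global115_117 (latticeSettingP12R n M a k) (gP12R M n a k) C Cα Cε Cαε)
    (hcb : 11 / 3 ≤ κ.cbar) (hcF : cFmax d ≤ κ.cF) (hcL : cLmax d ≤ κ.cL) (hc1 : c1max d ≤ κ.c1)
    {T : Fin d → VecR n M} {y y' : Tor M} (hT : ∀ ν c, T ν c ≠ 0 → c.1 ∈ cubeT n M y') {ε : ℝ} (hε0 : 0 < ε)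
    (hε1 : ε < 1) (ν : Fin d) {b₀ : Bnd n M} (hb₀ : b₀.1 ∈ cubeT n M y) :
    Dominated (Gs n M a) (Hs n M M₀) (Dgs n M) (ctr M M₀) (κ.cbar * M₀) κ (env C 0 (Cε ε) 0 0) 1
      (holderT n M ε (fun ν => cplx (T ν)) + ‖T‖) (sitePt M y) (sitePt M y') (divTR n M T)
      |gradR n M (GR n M a *ᵥ divTR n M T) ν b₀| := by
  have hA1 := one_le_env C 0 (Cε ε) 0 0
  have hCA : C + |Cε ε| ≤ env C 0 (Cε ε) 0 0 := by
    have := le_env C 0 (Cε ε) 0 0; simp only [abs_zero, add_zero] at this; exact this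
  have hCe := abs_nonneg (Cε ε)
  have hm : 0 ≤ holderT n M ε (fun ν => cplx (T ν)) + ‖T‖ := by
    refine add_nonneg ?_ (norm_nonneg T)
    unfold holderT LatticeNorms.holderSeminormB5; exact LatticeNorms.holderSeminorm_nonneg _ _ _ _ _ _
  obtain ⟨-, hF1, -, -, -⟩ := le_cFmax (d := d)
  obtain ⟨-, hLT, -⟩ := le_cLmax (d := d)
  obtain ⟨-, -, -, -, h1T, -⟩ := le_c1max (d := d)
  have hcF1 := one_le_cF1 (d := d)
  have hcLT := one_le_cLT (d := d)
  refine dominated_of_witness _ _ _ _ _ κ _ _ (divTR n M T) zero_le_one hm ?_ (Hs_divTR_eq_zero κ hn hM₀ hcb hT)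
    (fun z => size_ten_le k hn hM₀ hC.le hG z T hε0 hε1) (gradL n M ν b₀) ?_ ?_
  · have : cLT d * (C + |Cε ε|) ≤ κ.cL * env C 0 (Cε ε) 0 0 := mul_le_mul (hLT.trans hcL) hCA (by linarith) κ.cL_nonneg
    exact mul_le_mul_of_nonneg_right this hm
  · refine adm_of_bounds _ _ _ _ κ _ (divTR n M T) _ (F := cF1 d * C)
      (O := cF1 d * (cLT d * (C + |Cε ε|) * (holderT n M ε (fun ν => cplx (T ν)) + ‖T‖))) ?_ ?_ ?_ ?_
      (gradL_comp_Hs κ hn hM₀ hcb ν hb₀) ?_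
    · have : cF1 d * C ≤ κ.cF * env C 0 (Cε ε) 0 0 := mul_le_mul (hF1.trans hcF) (by linarith) hC.le κ.cF_nonneg
      linarith
    · have : cF1 d * (cLT d * (C + |Cε ε|)) ≤ κ.c1 * env C 0 (Cε ε) 0 0 := by
        rw [← mul_assoc]
        exact mul_le_mul (h1T.trans hc1) hCA (by linarith) κ.c1_nonneg
      calc cF1 d * (cLT d * (C + |Cε ε|) * (holderT n M ε (fun ν => cplx (T ν)) + ‖T‖))
          = cF1 d * (cLT d * (C + |Cε ε|)) * (holderT n M ε (fun ν => cplx (T ν)) + ‖T‖) := by ring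
        _ ≤ κ.c1 * env C 0 (Cε ε) 0 0 * (holderT n M ε (fun ν => cplx (T ν)) + ‖T‖) := mul_le_mul_of_nonneg_right this hm
        _ = _ := by ring
    · intro z B; rw [gradL_apply, Hs_Gs_eq, Real.norm_eq_abs]; exact abs_gradR_gz_G_le k hn hM₀ hC.le hG z B ν b₀
    · intro B; rw [gradL_apply, Gs_apply, Real.norm_eq_abs]
      exact (abs_gradR_G_le k hn hC.le hG B ν b₀).trans (by rw [mul_assoc]; exact le_mul_of_one_le_left (mul_nonneg hC.le (norm_nonneg B)) hcF1)
    · intro z; rw [gradL_apply, Hs_Gs_Hs_eq, Real.norm_eq_abs]; exact one_grad_ten_le k hn hM₀ hC.le hG z T hε0 hε1 ν b₀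
  · rw [gradL_apply, Gs_apply, Real.norm_eq_abs]

/-- **(1.113): THE HÖLDER QUOTIENT OF `ζ∇G∇*T` AT AN ADMISSIBLE PAIR IS DOMINATED** (direct walk; envelope
`env C (C_α α) (C_ε ε) (C_ε(α+ε)) (C_{α,ε} α ε)`, sizes `‖ζ‖_α + |ζ|`, `‖T‖_{α+ε} + |T|`).
[cite: Balaban1984PropagatorsI, (1.113) p.36, (1.125) p.38, (1.129)–(1.131) p.38] -/
theorem dominated_quotH_ten (hn : 1 ≤ n) (hM₀ : 1 ≤ M₀) (hC : 0 < C)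
    (hG : B5.Global115_117 (latticeSettingP12R n M a k) (gP12R M n a k) C Cα Cε Cαε)
    (hcb : 11 / 3 ≤ κ.cbar) (hcF : cFmax d ≤ κ.cF) (hcL : cLmax d ≤ κ.cL) (hc1 : c1max d ≤ κ.c1)
    {T : Fin d → VecR n M} {y y' : Tor M} (hT : ∀ ν c, T ν c ≠ 0 → c.1 ∈ cubeT n M y') {α ε : ℝ} (hα0 : 0 ≤ α)
    (hε0 : 0 < ε) (hαε : α + ε < 1) {ζ : Tor (fine n M) → ℝ} (hζ : cutInL n M ζ y) (ν μ : Fin d)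
    {x x' : Tor (fine n M)} (h1 : distU n M x x' ≤ 1) (h0 : 0 < distU n M x x') :
    Dominated (Gs n M a) (Hs n M M₀) (Dgs n M) (ctr M M₀) (κ.cbar * M₀) κ
      (env C (Cα α) (Cε ε) (Cε (α + ε)) (Cαε α ε)) (cutHL n M α ζ)
      (holderT n M (α + ε) (fun ν => cplx (T ν)) + ‖T‖) (sitePt M y) (sitePt M y') (divTR n M T)
      ((distU n M x x' ^ α)⁻¹ * |ζ x' * gradR n M (GR n M a *ᵥ divTR n M T) ν (x', μ)
        - ζ x * gradR n M (GR n M a *ᵥ divTR n M T) ν (x, μ)|) := by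
  set A := env C (Cα α) (Cε ε) (Cε (α + ε)) (Cαε α ε) with hAdef
  have hA1 : 1 ≤ A := one_le_env _ _ _ _ _
  have hCA : C + |Cα α| + |Cε ε| + |Cαε α ε| ≤ A := le_env _ _ _ _ _
  have hCa := abs_nonneg (Cα α); have hCe := abs_nonneg (Cε ε); have hCae := abs_nonneg (Cαε α ε)
  have hα1 : α < 1 := by linarith
  have hε1 : ε < 1 := by linarith
  have hm : 0 ≤ holderT n M (α + ε) (fun ν => cplx (T ν)) + ‖T‖ := by
    refine add_nonneg ?_ (norm_nonneg T)
    unfold holderT LatticeNorms.holderSeminormB5; exact LatticeNorms.holderSeminorm_nonneg _ _ _ _ _ _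
  have hs : 0 ≤ cutHL n M α ζ := B5Prop12FieldsLattice.cutHL_nonneg α ζ
  obtain ⟨-, -, -, hFH, -⟩ := le_cFmax (d := d)
  obtain ⟨-, hLT, -⟩ := le_cLmax (d := d)
  obtain ⟨-, -, -, -, -, h1H, -⟩ := le_c1max (d := d)
  have hcFH := one_le_cFH (d := d)
  have hcLT := one_le_cLT (d := d)
  rw [cutHL_eq] at hs ⊢
  refine dominated_of_witness _ _ _ _ _ κ _ _ (divTR n M T) hs hm ?_ (Hs_divTR_eq_zero κ hn hM₀ hcb hT)
    (fun z => (size_ten_le k hn hM₀ hC.le hG z T hε0 hε1).trans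
      (mul_le_mul_of_nonneg_left (holderT_add_norm_mono T hα0) (by nlinarith)))
    (quotL n M α ζ ν μ x x') ?_ ?_
  · have : cLT d * (C + |Cε ε|) ≤ κ.cL * A := mul_le_mul (hLT.trans hcL) (by linarith) (by linarith) κ.cL_nonneg
    exact mul_le_mul_of_nonneg_right this hm
  · refine adm_of_bounds _ _ _ _ κ _ (divTR n M T) _ (F := cFH d * (C + |Cα α|) * (holS n M α ζ + cutSupL n M ζ))
      (O := c1H d * (C + |Cα α| + |Cε ε| + |Cαε α ε|) * (holS n M α ζ + cutSupL n M ζ)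
        * (holderT n M (α + ε) (fun ν => cplx (T ν)) + ‖T‖)) ?_ ?_ ?_ ?_
      (quotL_comp_Hs κ hn hM₀ hcb α hζ ν μ x x') ?_
    · have : cFH d * (C + |Cα α|) ≤ κ.cF * A := mul_le_mul (hFH.trans hcF) (by linarith) (by linarith) κ.cF_nonneg
      exact mul_le_mul_of_nonneg_right this hs
    · have : c1H d * (C + |Cα α| + |Cε ε| + |Cαε α ε|) ≤ κ.c1 * A :=
        mul_le_mul (h1H.trans hc1) hCA (by linarith) κ.c1_nonneg
      exact mul_le_mul_of_nonneg_right (mul_le_mul_of_nonneg_right this hs) hm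
    · intro z B
      rw [quotL_apply, Hs_Gs_eq, Real.norm_eq_abs, abs_inv_rpow_mul h0]
      calc (distU n M x x' ^ α)⁻¹ * _ ≤ (distU n M x x' ^ α)⁻¹
            * (cFH d * (C + |Cα α|) * (holS n M α ζ + cutSupL n M ζ) * ‖B‖ * distU n M x x' ^ α) :=
            mul_le_mul_of_nonneg_left (quotH_gz_G_le k hn hM₀ hC.le hG z B hα0 hα1 ζ ν μ h1 h0)
              (inv_nonneg.mpr (Real.rpow_nonneg h0.le α))
        _ = _ := inv_rpow_mul_cancel h0 α _
    · intro B
      rw [quotL_apply, Gs_apply, Real.norm_eq_abs, abs_inv_rpow_mul h0]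
      calc (distU n M x x' ^ α)⁻¹ * _ ≤ (distU n M x x' ^ α)⁻¹
            * ((C + |Cα α|) * (holS n M α ζ + cutSupL n M ζ) * ‖B‖ * distU n M x x' ^ α) :=
            mul_le_mul_of_nonneg_left (quotH_G_le k hn hC.le hG B hα0 hα1 ζ ν μ h1 h0)
              (inv_nonneg.mpr (Real.rpow_nonneg h0.le α))
        _ = (C + |Cα α|) * (holS n M α ζ + cutSupL n M ζ) * ‖B‖ := inv_rpow_mul_cancel h0 α _
        _ ≤ _ := by
            have : (C + |Cα α|) * (holS n M α ζ + cutSupL n M ζ) ≤ cFH d * (C + |Cα α|) * (holS n M α ζ + cutSupL n M ζ) := by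
              have h' : (C + |Cα α|) ≤ cFH d * (C + |Cα α|) := le_mul_of_one_le_left (by linarith) hcFH
              exact mul_le_mul_of_nonneg_right h' hs
            exact mul_le_mul_of_nonneg_right this (norm_nonneg B)
    · intro z
      rw [quotL_apply, Hs_Gs_Hs_eq, Real.norm_eq_abs, abs_inv_rpow_mul h0]
      calc (distU n M x x' ^ α)⁻¹ * _ ≤ (distU n M x x' ^ α)⁻¹
            * (c1H d * (C + |Cα α| + |Cε ε| + |Cαε α ε|) * (holS n M α ζ + cutSupL n M ζ)
              * (holderT n M (α + ε) (fun ν => cplx (T ν)) + ‖T‖) * distU n M x x' ^ α) :=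
            mul_le_mul_of_nonneg_left (one_quotH_ten_le k hn hM₀ hC.le hG z T hα0 hε0 hαε ζ ν μ h1 h0)
              (inv_nonneg.mpr (Real.rpow_nonneg h0.le α))
        _ = _ := inv_rpow_mul_cancel h0 α _
  · rw [quotL_apply, Gs_apply, Real.norm_eq_abs, abs_inv_rpow_mul h0]

end Direct

/-! ## §4 The adjoint problems are dominated (p. 39) -/

section Adjoint

variable {n : ℕ} [NeZero n] {M : Fin d → ℕ} [hM : ∀ μ, NeZero (M μ)] {a : ℝ} {M₀ : ℕ} (k : ℕ) (κ : SupConsts)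
  {C : ℝ} {Cα Cε : ℝ → ℝ} {Cαε : ℝ → ℝ → ℝ}

omit [NeZero n] hM in
/-- `ofLp (toLp v) = v` on `V1`. [cite: Balaban1984PropagatorsI, p.39 L7–9] -/
theorem ofLp_toLp_V1 (v : VecR n M) : ofLp (toLp 1 v : V1 n M) = v := rfl

/-- **(1.110), `m = 2`: THE POINT VALUE `|(G∇*T)(b₀)|`, `b₀ ∈ Δ̃(y)`, `supp T ⊂ Δ̃(y′)`, IS DOMINATED ON THE ADJOINT
REPRESENTATION** (monopole source `|T|·e_{b₀}` at `y`, output `|T|⁻¹⟨∇·, T⟩` at `y′`; envelope `env C 0 0 0 0`, sizes `1`, `|T|`).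
[cite: Balaban1984PropagatorsI, (1.110) p.35, p.39 L7–9, (1.125), (1.129)–(1.131) p.38] -/
theorem dominated_eval_adj (hn : 1 ≤ n) (ha : 0 < a) (hM₀ : 1 ≤ M₀) (hC : 0 < C)
    (hG : B5.Global115_117 (latticeSettingP12R n M a k) (gP12R M n a k) C Cα Cε Cαε)
    (hcb : 11 / 3 ≤ κ.cbar) (hcF : cFmax d ≤ κ.cF) (hcL : cLmax d ≤ κ.cL) (hc1 : c1max d ≤ κ.c1)
    {T : Fin d → VecR n M} {y y' : Tor M} (hT : ∀ ν c, T ν c ≠ 0 → c.1 ∈ cubeT n M y') (hT0 : ‖T‖ ≠ 0)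
    {b₀ : Bnd n M} (hb₀ : b₀.1 ∈ cubeT n M y) :
    Dominated (G1 n M a) (H1 n M M₀) (Dg1 n M) (ctr M M₀) (κ.cbar * M₀) κ (env C 0 0 0 0) 1 ‖T‖
      (sitePt M y') (sitePt M y) (toLp 1 (‖T‖ • mono n M b₀)) |(GR n M a *ᵥ divTR n M T) b₀| := by
  have hA1 := one_le_env C 0 0 0 0
  have hCA : C ≤ env C 0 0 0 0 := by have := le_env C 0 0 0 0; simp only [abs_zero, add_zero] at this; exact this
  have hTn := norm_nonneg T
  have hTpos : 0 < ‖T‖ := lt_of_le_of_ne hTn (Ne.symm hT0)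
  obtain ⟨-, -, -, -, hFd⟩ := le_cFmax (d := d)
  obtain ⟨hL2, -, -⟩ := le_cLmax (d := d)
  obtain ⟨-, -, -, -, -, -, h1d, -⟩ := le_c1max (d := d)
  have hdL : 0 ≤ (d : ℝ) * Lw d := mul_nonneg (Nat.cast_nonneg d) (Lw_nonneg d)
  -- the source is supported at `b₀ ∈ Δ̃(y)`
  have hsupp : ∀ c, (‖T‖ • mono n M b₀) c ≠ 0 → c.1 ∈ cubeT n M y := by
    intro c hc
    have : mono n M b₀ c ≠ 0 := by
      intro h0; apply hc; rw [Pi.smul_apply, h0, smul_zero]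
    unfold mono at this
    rw [Pi.single_apply] at this
    by_cases hcb0 : c = b₀
    · rw [hcb0]; exact hb₀
    · exact absurd (if_neg hcb0) this
  refine dominated_of_witness _ _ _ _ _ κ _ _ _ (L := 2 * C * ‖T‖) zero_le_one hTn ?_ (H1_src_eq_zero κ hn hM₀ hcb hsupp) ?_
    ((‖T‖)⁻¹ • pairL n M T) ?_ ?_
  · have : 2 * C ≤ κ.cL * env C 0 0 0 0 := by nlinarith [κ.cL_nonneg]
    nlinarith
  · intro z
    rw [size_Dg1, ofLp_G1_H1, ofLp_toLp_V1]
    have h := last_mono_le k hn ha hC.le hG z b₀ ‖T‖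
    have e : (fun b => gz n M M₀ z b * (‖T‖ * mono n M b₀ b)) = fun b => gz n M M₀ z b * (‖T‖ • mono n M b₀) b := by
      funext b; simp only [Pi.smul_apply, smul_eq_mul]
    rw [e, abs_of_pos hTpos] at h
    exact h
  · refine adm_of_bounds _ _ _ _ κ _ _ _ (F := (1 + d * Lw d) * C) (O := (1 + d * Lw d) * C * ‖T‖) ?_ ?_ ?_ ?_ ?_ ?_
    · have : (1 + d * Lw d) * C ≤ κ.cF * env C 0 0 0 0 := mul_le_mul (hFd.trans hcF) hCA hC.le κ.cF_nonneg
      linarith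
    · have : (1 + d * Lw d) * C ≤ κ.c1 * env C 0 0 0 0 := mul_le_mul (h1d.trans hc1) hCA hC.le κ.c1_nonneg
      nlinarith
    · intro z B
      rw [LinearMap.smul_apply, pairL_apply, ofLp_H1, ofLp_G1, Real.norm_eq_abs, smul_eq_mul, abs_mul,
        abs_of_pos (inv_pos.mpr hTpos)]
      have h := abs_pair_gz_G_le k hn ha hM₀ hC.le hG z T (ofLp B)
      rw [← norm_V1_eq_l1] at h
      calc ‖T‖⁻¹ * |pair n M T fun b => gz n M M₀ z b * (GR n M a *ᵥ ofLp B) b|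
          ≤ ‖T‖⁻¹ * ((1 + d * Lw d) * C * ‖B‖ * ‖T‖) := mul_le_mul_of_nonneg_left h (inv_nonneg.mpr hTn)
        _ = (1 + d * Lw d) * C * ‖B‖ := by field_simp
    · intro B
      rw [LinearMap.smul_apply, pairL_apply, ofLp_G1, Real.norm_eq_abs, smul_eq_mul, abs_mul, abs_of_pos (inv_pos.mpr hTpos)]
      have h := abs_pair_G_le k hn ha hC.le hG T (ofLp B)
      rw [← norm_V1_eq_l1] at h
      calc ‖T‖⁻¹ * |pair n M T (GR n M a *ᵥ ofLp B)| ≤ ‖T‖⁻¹ * (C * ‖B‖ * ‖T‖) :=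
            mul_le_mul_of_nonneg_left h (inv_nonneg.mpr hTn)
        _ = C * ‖B‖ := by field_simp
        _ ≤ (1 + d * Lw d) * C * ‖B‖ := by
            rw [mul_assoc]; exact le_mul_of_one_le_left (mul_nonneg hC.le (norm_nonneg B)) (by linarith)
    · intro z hfar
      rw [LinearMap.smul_comp, pairL_comp_H1 κ hn hM₀ hcb hT z hfar, smul_zero]
    · intro z
      rw [LinearMap.smul_apply, pairL_apply, ofLp_H1, ofLp_G1_H1, ofLp_toLp_V1, Real.norm_eq_abs, smul_eq_mul, abs_mul,
        abs_of_pos (inv_pos.mpr hTpos)]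
      have key : pair n M T (fun b => gz n M M₀ z b * (GR n M a *ᵥ fun b' => gz n M M₀ z b' * (‖T‖ • mono n M b₀) b') b)
          = ‖T‖ * (gz n M M₀ z b₀ * (GR n M a *ᵥ fun b' => gz n M M₀ z b' * divTR n M T b') b₀) := by
        rw [pair_gz_G_gz_eq hn ha]
        simp only [Pi.smul_apply, smul_eq_mul, mul_assoc, ← Finset.mul_sum]
        rw [sum_mono_mul]
      rw [key, abs_mul, abs_of_pos hTpos]
      have h := abs_gz_G_gz_divTR_le k hn hM₀ hC.le hG z T b₀
      calc ‖T‖⁻¹ * (‖T‖ * _) = |gz n M M₀ z b₀ * (GR n M a *ᵥ fun b' => gz n M M₀ z b' * divTR n M T b') b₀| := by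
            field_simp
        _ ≤ (1 + d * Lw d) * C * ‖T‖ := h
  · rw [LinearMap.smul_apply, pairL_apply, ofLp_G1, ofLp_toLp_V1, Real.norm_eq_abs, smul_eq_mul, Matrix.mulVec_smul,
      pair_smul, pair_G_eq hn ha, sum_mono_mul, ← mul_assoc, inv_mul_cancel₀ hT0, one_mul]

/-- **(1.111), tensor summand: THE HÖLDER QUOTIENT OF `ζG∇*T` AT AN ADMISSIBLE PAIR IS DOMINATED ON THE ADJOINT
REPRESENTATION** (source `(|T|/(‖ζ‖_α+|ζ|))·|x−x′|^{−α}(ζ(x′)e_{x′μ} − ζ(x)e_{xμ})` at `y`, output `((‖ζ‖_α+|ζ|)/|T|)⟨∇·, T⟩` at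
`y′`; envelope `env C (C_α α) 0 0 0`, sizes `‖ζ‖_α + |ζ|`, `|T|`). [cite: Balaban1984PropagatorsI, (1.111) p.35, p.39 L7–9, (1.125), (1.129)–(1.131) p.38] -/
theorem dominated_quotH_adj (hn : 1 ≤ n) (ha : 0 < a) (hM₀ : 1 ≤ M₀) (hC : 0 < C)
    (hG : B5.Global115_117 (latticeSettingP12R n M a k) (gP12R M n a k) C Cα Cε Cαε)
    (hcb : 11 / 3 ≤ κ.cbar) (hcF : cFmax d ≤ κ.cF) (hcL : cLmax d ≤ κ.cL) (hc1 : c1max d ≤ κ.c1)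
    {T : Fin d → VecR n M} {y y' : Tor M} (hT : ∀ ν c, T ν c ≠ 0 → c.1 ∈ cubeT n M y') (hT0 : ‖T‖ ≠ 0)
    {α : ℝ} (hα0 : 0 ≤ α) (hα1 : α < 1) {ζ : Tor (fine n M) → ℝ} (hζ : cutInL n M ζ y) (hζ0 : cutHL n M α ζ ≠ 0)
    (μ : Fin d) {x x' : Tor (fine n M)} (h1 : distU n M x x' ≤ 1) (h0 : 0 < distU n M x x') :
    Dominated (G1 n M a) (H1 n M M₀) (Dg1 n M) (ctr M M₀) (κ.cbar * M₀) κ (env C (Cα α) 0 0 0) (cutHL n M α ζ) ‖T‖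
      (sitePt M y') (sitePt M y)
      (toLp 1 ((‖T‖ / cutHL n M α ζ * (distU n M x x' ^ α)⁻¹) • cutSrc n M ζ μ x x'))
      ((distU n M x x' ^ α)⁻¹ * |ζ x' * (GR n M a *ᵥ divTR n M T) (x', μ) - ζ x * (GR n M a *ᵥ divTR n M T) (x, μ)|) := by
  have hA1 := one_le_env C (Cα α) 0 0 0
  have hCA : C + |Cα α| ≤ env C (Cα α) 0 0 0 := by
    have := le_env C (Cα α) 0 0 0; simp only [abs_zero, add_zero] at this; exact this
  have hCa := abs_nonneg (Cα α)
  have hTn := norm_nonneg T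
  have hTpos : 0 < ‖T‖ := lt_of_le_of_ne hTn (Ne.symm hT0)
  have hs : 0 ≤ cutHL n M α ζ := B5Prop12FieldsLattice.cutHL_nonneg α ζ
  have hspos : 0 < cutHL n M α ζ := lt_of_le_of_ne hs (Ne.symm hζ0)
  have ht : 0 < distU n M x x' ^ α := Real.rpow_pos_of_pos h0 α
  obtain ⟨-, -, -, -, hFd⟩ := le_cFmax (d := d)
  obtain ⟨-, -, hLA⟩ := le_cLmax (d := d)
  obtain ⟨-, -, -, -, -, -, h1d, h1A⟩ := le_c1max (d := d)
  have hdL : 0 ≤ (d : ℝ) * Lw d := mul_nonneg (Nat.cast_nonneg d) (Lw_nonneg d)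
  set c : ℝ := ‖T‖ / cutHL n M α ζ * (distU n M x x' ^ α)⁻¹ with hc
  have hcpos : 0 < c := mul_pos (div_pos hTpos hspos) (inv_pos.mpr ht)
  have hsupp : ∀ b, (c • cutSrc n M ζ μ x x') b ≠ 0 → b.1 ∈ cubeT n M y := by
    intro b hb
    have : cutSrc n M ζ μ x x' b ≠ 0 := by
      intro h0'; apply hb; rw [Pi.smul_apply, h0', smul_zero]
    exact hζ b.1 (cut_ne_zero_of_cutSrc_ne_zero this)
  have ht' : distU n M x x' ^ α ≠ 0 := ht.ne'
  have hcc : cutHL n M α ζ / ‖T‖ * c = (distU n M x x' ^ α)⁻¹ := by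
    rw [hc, ← mul_assoc, div_mul_div_comm, mul_comm (cutHL n M α ζ) ‖T‖, div_self (mul_ne_zero hT0 hζ0), one_mul]
  have hc2 : c * (cutHL n M α ζ * distU n M x x' ^ α) = ‖T‖ := by
    rw [hc, mul_mul_mul_comm, div_mul_cancel₀ _ hζ0, inv_mul_cancel₀ ht', mul_one]
  refine dominated_of_witness _ _ _ _ _ κ _ _ _ (L := cLA d * (C + |Cα α|) * ‖T‖) hs hTn ?_
    (H1_src_eq_zero κ hn hM₀ hcb hsupp) ?_ ((cutHL n M α ζ / ‖T‖) • pairL n M T) ?_ ?_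
  · have : cLA d * (C + |Cα α|) ≤ κ.cL * env C (Cα α) 0 0 0 := mul_le_mul (hLA.trans hcL) hCA (by linarith) κ.cL_nonneg
    exact mul_le_mul_of_nonneg_right this hTn
  · intro z
    rw [size_Dg1, ofLp_G1_H1, ofLp_toLp_V1, G_gz_smul, l1grad_smul, l1_smul, ← mul_add, abs_of_pos hcpos]
    have h := size_cutSrc_le k hn ha hM₀ hC.le hG z hα0 hα1 ζ μ h1 h0
    rw [← cutHL_eq] at h
    calc c * _ ≤ c * (cLA d * (C + |Cα α|) * cutHL n M α ζ * distU n M x x' ^ α) := mul_le_mul_of_nonneg_left h hcpos.le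
      _ = cLA d * (C + |Cα α|) * (c * (cutHL n M α ζ * distU n M x x' ^ α)) := by ring
      _ = cLA d * (C + |Cα α|) * ‖T‖ := by rw [hc2]
  · refine adm_of_bounds _ _ _ _ κ _ _ _ (F := (1 + d * Lw d) * C * cutHL n M α ζ)
      (O := (c1A d + 1 + d * Lw d) * (C + |Cα α|) * cutHL n M α ζ * ‖T‖) ?_ ?_ ?_ ?_ ?_ ?_
    · have : (1 + d * Lw d) * C ≤ κ.cF * env C (Cα α) 0 0 0 := mul_le_mul (hFd.trans hcF) (by linarith) hC.le κ.cF_nonneg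
      exact mul_le_mul_of_nonneg_right this hs
    · have : (c1A d + 1 + d * Lw d) * (C + |Cα α|) ≤ κ.c1 * env C (Cα α) 0 0 0 :=
        mul_le_mul (h1A.trans hc1) hCA (by linarith) κ.c1_nonneg
      exact mul_le_mul_of_nonneg_right (mul_le_mul_of_nonneg_right this hs) hTn
    · intro z B
      rw [LinearMap.smul_apply, pairL_apply, ofLp_H1, ofLp_G1, Real.norm_eq_abs, smul_eq_mul, abs_mul,
        abs_of_pos (div_pos hspos hTpos)]
      have h := abs_pair_gz_G_le k hn ha hM₀ hC.le hG z T (ofLp B)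
      rw [← norm_V1_eq_l1] at h
      calc cutHL n M α ζ / ‖T‖ * |pair n M T fun b => gz n M M₀ z b * (GR n M a *ᵥ ofLp B) b|
          ≤ cutHL n M α ζ / ‖T‖ * ((1 + d * Lw d) * C * ‖B‖ * ‖T‖) :=
            mul_le_mul_of_nonneg_left h (div_nonneg hs hTn)
        _ = (1 + d * Lw d) * C * cutHL n M α ζ * ‖B‖ := by field_simp
    · intro B
      rw [LinearMap.smul_apply, pairL_apply, ofLp_G1, Real.norm_eq_abs, smul_eq_mul, abs_mul, abs_of_pos (div_pos hspos hTpos)]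
      have h := abs_pair_G_le k hn ha hC.le hG T (ofLp B)
      rw [← norm_V1_eq_l1] at h
      calc cutHL n M α ζ / ‖T‖ * |pair n M T (GR n M a *ᵥ ofLp B)| ≤ cutHL n M α ζ / ‖T‖ * (C * ‖B‖ * ‖T‖) :=
            mul_le_mul_of_nonneg_left h (div_nonneg hs hTn)
        _ = C * cutHL n M α ζ * ‖B‖ := by field_simp
        _ ≤ (1 + d * Lw d) * C * cutHL n M α ζ * ‖B‖ := by
            have : C * cutHL n M α ζ ≤ (1 + d * Lw d) * C * cutHL n M α ζ := by
              rw [mul_assoc]; exact le_mul_of_one_le_left (mul_nonneg hC.le hs) (by linarith)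
            exact mul_le_mul_of_nonneg_right this (norm_nonneg B)
    · intro z hfar
      rw [LinearMap.smul_comp, pairL_comp_H1 κ hn hM₀ hcb hT z hfar, smul_zero]
    · intro z
      rw [LinearMap.smul_apply, pairL_apply, ofLp_H1, ofLp_G1_H1, ofLp_toLp_V1, Real.norm_eq_abs, smul_eq_mul,
        G_gz_smul]
      have e : (fun b => gz n M M₀ z b * (c • (GR n M a *ᵥ fun b' => gz n M M₀ z b' * cutSrc n M ζ μ x x' b')) b)
          = c • fun b => gz n M M₀ z b * (GR n M a *ᵥ fun b' => gz n M M₀ z b' * cutSrc n M ζ μ x x' b') b := by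
        funext b; simp only [Pi.smul_apply, smul_eq_mul]; ring
      rw [e, pair_smul, pair_gz_G_gz_eq hn ha, sum_cutSrc_mul, abs_mul, abs_mul, abs_of_pos (div_pos hspos hTpos),
        abs_of_pos hcpos]
      have h := one_cutSrc_le k hn hM₀ hC.le hG z T hα0 hα1 ζ μ h1 h0
      rw [← cutHL_eq] at h
      calc cutHL n M α ζ / ‖T‖ * (c * _)
          ≤ cutHL n M α ζ / ‖T‖ * (c * ((c1A d + 1 + d * Lw d) * (C + |Cα α|) * cutHL n M α ζ * ‖T‖ * distU n M x x' ^ α)) :=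
            mul_le_mul_of_nonneg_left (mul_le_mul_of_nonneg_left h hcpos.le) (div_nonneg hs hTn)
        _ = (cutHL n M α ζ / ‖T‖ * c) * distU n M x x' ^ α
            * ((c1A d + 1 + d * Lw d) * (C + |Cα α|) * cutHL n M α ζ * ‖T‖) := by ring
        _ = (c1A d + 1 + d * Lw d) * (C + |Cα α|) * cutHL n M α ζ * ‖T‖ := by rw [hcc, inv_mul_cancel₀ ht', one_mul]
  · rw [LinearMap.smul_apply, pairL_apply, ofLp_G1, ofLp_toLp_V1, Real.norm_eq_abs, smul_eq_mul, Matrix.mulVec_smul,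
      pair_smul, pair_G_eq hn ha, sum_cutSrc_mul, abs_mul, abs_mul, abs_of_pos (div_pos hspos hTpos), abs_of_pos hcpos,
      ← mul_assoc, hcc]

end Adjoint

end

end Literature.MathematicalPhysics.QuantumFieldTheory.Balaban1983to89.B5SupDominatedTorus
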